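import Summits.QuantumFields.YangMills.Theorems.PencilRigidityWeakCouplingHypercubicLimitStubTraceCluster
import Literature.MathematicalPhysics.QuantumFieldTheory.Balaban1983to89.Beta.BulkParametrix
import HarnessLib

/-!
# Line `vacuum_escape` (crux `BalabanLadder.IR`, stmt-QuantumFields-19354) — spectral seam, part 1/3:
# finite-dimensional trace inequalities (the thermal double sum at TOTAL time `a + b`)

Helper toward the registered stub `stub_spectralSeam : SliceGapInUnits ∧ ColdPurity ⇒ GapInUnits` of the skeleton
`Cruxes/IR/Lines/vacuum_escape.lean` (ideator ym-ir-idea-8; pooled prover ym-ir-line-pool-p3).  The tree's trace cluster bound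
`TraceNormColdPressure.stub_traceCluster` controls the thermal double sum `tr((Tᵃ − P) A (Tᵇ − P) B)` by `rᵇ · (tr Tᵃ − 1)` — a trace
excess at the ONE-SIDED time `a = P − n − w`, which on the symmetric torus `P = 2S+1` near the antipode `n ≈ S` drops BELOW the
half period `S + 1` where the thermal face `ColdPurity` lives.  This file replaces that term by a trace excess at the TOTAL time
`a + b = P − 2w ≥ S + 1`:

* `abs_trace_pow_mul_pow_mul_le` — for a positive operator `S` on a finite-dimensional real inner product space and bounded
  `M, M'`: `|tr(Sᵃ M Sᵇ M')| ≤ 2 ‖M‖ ‖M'‖ tr S^{a+b}` (eigenbasis of `S`, `μᵢᵃ μⱼᵇ ≤ μᵢ^{a+b} + μⱼ^{a+b}` = tree `BulkParametrix.pow_mul_pow_le_add`, Cauchy–Schwarz on rows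
  and columns, Bessel) — the weighted-AM–GM form of the Schatten–Hölder inequality `‖Dᵃ X Dᵇ‖₁ ≤ ‖X‖ tr D^{a+b}`;
* `pow_sub_rankOne_mul` — `(Tˢ − P)(Tᵗ − P) = T^{s+t} − P` for `P = |Ω⟩⟨Ω|`, `T Ω = Ω`, `T ≥ 0`; hence `(T − P)ᵃ = Tᵃ − P` (`a ≥ 1`)
  and the model-level monotonicity `tr Tᵗ − 1 ≤ r^{t − t₀} (tr T^{t₀} − 1)` (`trace_excess_le_pow_mul`);
* `traceCluster_total` — the cluster bound with the thermal term `2 (tr T^{a+b} − 1)` in place of `rᵇ (tr Tᵃ − 1)`.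

Pure finite-dimensional linear algebra [folklore]; no Yang–Mills content.  HONEST FRAMING: plumbing for ONE format seam of ONE line of an
open crux of a CONDITIONAL chain; nothing here bears on the Yang–Mills mass gap (Clay), a lattice gap or `BalabanLadder.IR`; R4 of the
ladder closes only the conditional finite-𝕋⁴ rung `BalabanLadder.UV`.
-/

noncomputable section

open scoped BigOperators InnerProductSpace
open InnerProductSpace
open Summit.QuantumFields.YangMills.Theorems.WeakCouplingHypercubicLimit.TraceNormColdPressure
  (stub_traceHolder toolkit_powSubRankOne abs_real_inner_apply_le_opNorm trace_rankOne_mul_eq trace_pow_sub_rankOne_eq)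
open Literature.MathematicalPhysics.QuantumFieldTheory.Balaban1983to89.Beta.BulkParametrix (pow_mul_pow_le_add)

namespace Summit.QuantumFields.YangMills.Cruxes.IR.VacuumEscape.SpectralSeam

/-! ## §1 The Young-weighted trace inequality `|tr(Sᵃ M Sᵇ M')| ≤ 2‖M‖‖M'‖ tr S^{a+b}` -/

section Young

variable {E : Type*} [NormedAddCommGroup E] [InnerProductSpace ℝ E]

/-- Powers of an operator act diagonally on an eigenvector: `S (e) = μ • e ⇒ Sᵃ e = μᵃ • e`. [folklore] -/
theorem pow_apply_of_apply_eq_smul (S : E →L[ℝ] E) {e : E} {μ : ℝ} (he : S e = μ • e) (a : ℕ) :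
    (S ^ a) e = μ ^ a • e := by
  induction a with
  | zero => simp
  | succ a ih =>
    rw [pow_succ, mul_apply_eq_comp, he, map_smul, ih, smul_smul, pow_succ, mul_comm]

/-- For a symmetric `S` with `S e = μ • e`: `⟪e, Sᵃ x⟫ = μᵃ ⟪e, x⟫`. [folklore] -/
theorem inner_pow_apply_of_apply_eq_smul {S : E →L[ℝ] E} (hS : (S : E →ₗ[ℝ] E).IsSymmetric) {e : E}
    {μ : ℝ} (he : S e = μ • e) (a : ℕ) (x : E) :
    inner ℝ e ((S ^ a) x) = μ ^ a * inner ℝ e x := by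
  induction a generalizing x with
  | zero => simp
  | succ a ih =>
    rw [pow_succ, mul_apply_eq_comp, ih (S x)]
    have h : inner ℝ e (S x) = inner ℝ (S e) x := (hS e x).symm
    rw [h, he, real_inner_smul_left, pow_succ]
    ring

variable [FiniteDimensional ℝ E]

/-- Row Cauchy–Schwarz–Bessel: for an orthonormal basis `b`, bounded `M, M'` and any index `i`,
`Σⱼ |⟪b i, M (b j)⟫| · |⟪b j, M' (b i)⟫| ≤ ‖M‖ ‖M'‖`. [folklore] -/
theorem sum_abs_inner_mul_abs_inner_le {ι : Type*} [Fintype ι] (b : OrthonormalBasis ι ℝ E)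
    (M M' : E →L[ℝ] E) (i : ι) :
    ∑ j, |inner ℝ (b i) (M (b j))| * |inner ℝ (b j) (M' (b i))| ≤ ‖M‖ * ‖M'‖ := by
  haveI : CompleteSpace E := FiniteDimensional.complete ℝ E
  -- Bessel for the two coordinate vectors
  have h1 : ∑ j, (inner ℝ (b i) (M (b j))) ^ 2 ≤ ‖M‖ ^ 2 := by
    have hB := b.orthonormal.sum_inner_products_le (s := Finset.univ) ((ContinuousLinearMap.adjoint M) (b i))
    have e : ∀ j, inner ℝ (b i) (M (b j)) = inner ℝ (b j) ((ContinuousLinearMap.adjoint M) (b i)) := by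
      intro j
      rw [ContinuousLinearMap.adjoint_inner_right, real_inner_comm]
    calc ∑ j, (inner ℝ (b i) (M (b j))) ^ 2
        = ∑ j, ‖inner ℝ (b j) ((ContinuousLinearMap.adjoint M) (b i))‖ ^ 2 := by
          refine Finset.sum_congr rfl fun j _ => ?_
          rw [e j, Real.norm_eq_abs, sq_abs]
      _ ≤ ‖(ContinuousLinearMap.adjoint M) (b i)‖ ^ 2 := hB
      _ ≤ (‖ContinuousLinearMap.adjoint M‖ * ‖b i‖) ^ 2 := by
          gcongr; exact ContinuousLinearMap.le_opNorm _ _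
      _ = ‖M‖ ^ 2 := by rw [b.orthonormal.1 i, mul_one, ContinuousLinearMap.adjoint.norm_map]
  have h2 : ∑ j, (inner ℝ (b j) (M' (b i))) ^ 2 ≤ ‖M'‖ ^ 2 := by
    have hB := b.orthonormal.sum_inner_products_le (s := Finset.univ) (M' (b i))
    calc ∑ j, (inner ℝ (b j) (M' (b i))) ^ 2
        = ∑ j, ‖inner ℝ (b j) (M' (b i))‖ ^ 2 := by
          refine Finset.sum_congr rfl fun j _ => ?_
          rw [Real.norm_eq_abs, sq_abs]
      _ ≤ ‖M' (b i)‖ ^ 2 := hB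
      _ ≤ (‖M'‖ * ‖b i‖) ^ 2 := by gcongr; exact ContinuousLinearMap.le_opNorm _ _
      _ = ‖M'‖ ^ 2 := by rw [b.orthonormal.1 i, mul_one]
  -- Cauchy–Schwarz
  have hCS := Finset.sum_mul_sq_le_sq_mul_sq Finset.univ
    (fun j => |inner ℝ (b i) (M (b j))|) (fun j => |inner ℝ (b j) (M' (b i))|)
  simp only [sq_abs] at hCS
  have h0 : 0 ≤ ∑ j, |inner ℝ (b i) (M (b j))| * |inner ℝ (b j) (M' (b i))| :=
    Finset.sum_nonneg fun j _ => mul_nonneg (abs_nonneg _) (abs_nonneg _)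
  have hsq : (∑ j, |inner ℝ (b i) (M (b j))| * |inner ℝ (b j) (M' (b i))|) ^ 2 ≤ (‖M‖ * ‖M'‖) ^ 2 := by
    calc _ ≤ (∑ j, (inner ℝ (b i) (M (b j))) ^ 2) * ∑ j, (inner ℝ (b j) (M' (b i))) ^ 2 := hCS
      _ ≤ ‖M‖ ^ 2 * ‖M'‖ ^ 2 :=
          mul_le_mul h1 h2 (Finset.sum_nonneg fun j _ => sq_nonneg _) (sq_nonneg _)
      _ = (‖M‖ * ‖M'‖) ^ 2 := by ring
  exact (pow_le_pow_iff_left₀ h0 (by positivity) two_ne_zero).1 hsq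

/-- **Young-weighted trace inequality.**  For a positive operator `S` on a finite-dimensional real inner product space
and bounded `M, M'`: `|tr(Sᵃ M Sᵇ M')| ≤ 2 ‖M‖ ‖M'‖ tr S^{a+b}`.  Proof: in an orthonormal eigenbasis of `S`
(eigenvalues `μᵢ ≥ 0`), `tr(Sᵃ M Sᵇ M') = Σᵢⱼ μᵢᵃ μⱼᵇ Mᵢⱼ M'ⱼᵢ`, `μᵢᵃ μⱼᵇ ≤ μᵢ^{a+b} + μⱼ^{a+b}`, and each row/column
sum `Σⱼ |Mᵢⱼ| |M'ⱼᵢ|` is `≤ ‖M‖‖M'‖` by Cauchy–Schwarz and Bessel. [folklore] -/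
theorem abs_trace_pow_mul_pow_mul_le {S : E →L[ℝ] E} (hS : S.IsPositive) (M M' : E →L[ℝ] E)
    (a b : ℕ) :
    |LinearMap.trace ℝ E (↑(S ^ a * M * S ^ b * M') : E →ₗ[ℝ] E)| ≤
      2 * ‖M‖ * ‖M'‖ * LinearMap.trace ℝ E (↑(S ^ (a + b)) : E →ₗ[ℝ] E) := by
  classical
  have hsym : (S : E →ₗ[ℝ] E).IsSymmetric := hS.isSymmetric
  set n : ℕ := Module.finrank ℝ E with hn
  set bs : OrthonormalBasis (Fin n) ℝ E := hsym.eigenvectorBasis hn.symm with hbs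
  set μ : Fin n → ℝ := fun i => hsym.eigenvalues hn.symm i with hμ
  have heig : ∀ i, S (bs i) = μ i • bs i := by
    intro i
    have h := hsym.apply_eigenvectorBasis hn.symm i
    simpa only [ContinuousLinearMap.coe_coe, RCLike.ofReal_real_eq_id, id_eq] using h
  have hμ0 : ∀ i, 0 ≤ μ i := by
    intro i
    have h := hS.inner_nonneg_right (bs i)
    rw [heig i, real_inner_smul_right, real_inner_self_eq_norm_sq, bs.orthonormal.1 i, one_pow,
      mul_one] at h
    exact h
  -- the trace as a double sum
  have hentry : ∀ i, inner ℝ (bs i) ((S ^ a * M * S ^ b * M') (bs i)) =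
      ∑ j, μ i ^ a * μ j ^ b * (inner ℝ (bs i) (M (bs j)) * inner ℝ (bs j) (M' (bs i))) := by
    intro i
    have e1 : (S ^ a * M * S ^ b * M') (bs i) = (S ^ a) (M ((S ^ b) (M' (bs i)))) := by
      simp only [mul_apply_eq_comp]
    rw [e1, inner_pow_apply_of_apply_eq_smul hsym (heig i) a]
    -- expand `M' (bs i)` in the basis
    have e2 : (S ^ b) (M' (bs i)) = ∑ j, (inner ℝ (bs j) (M' (bs i)) * μ j ^ b) • bs j := by
      conv_lhs => rw [← bs.sum_repr' (M' (bs i))]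
      rw [map_sum]
      refine Finset.sum_congr rfl fun j _ => ?_
      rw [map_smul, pow_apply_of_apply_eq_smul S (heig j) b, smul_smul]
    rw [e2, map_sum, inner_sum, Finset.mul_sum]
    refine Finset.sum_congr rfl fun j _ => ?_
    rw [map_smul, real_inner_smul_right]
    ring
  have htr : LinearMap.trace ℝ E (↑(S ^ a * M * S ^ b * M') : E →ₗ[ℝ] E) =
      ∑ i, ∑ j, μ i ^ a * μ j ^ b * (inner ℝ (bs i) (M (bs j)) * inner ℝ (bs j) (M' (bs i))) := by
    rw [LinearMap.trace_eq_sum_inner _ bs]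
    refine Finset.sum_congr rfl fun i _ => ?_
    rw [ContinuousLinearMap.coe_coe, hentry i]
  have htrS : LinearMap.trace ℝ E (↑(S ^ (a + b)) : E →ₗ[ℝ] E) = ∑ i, μ i ^ (a + b) := by
    rw [LinearMap.trace_eq_sum_inner _ bs]
    refine Finset.sum_congr rfl fun i _ => ?_
    rw [ContinuousLinearMap.coe_coe, pow_apply_of_apply_eq_smul S (heig i) (a + b), real_inner_smul_right,
      real_inner_self_eq_norm_sq, bs.orthonormal.1 i, one_pow, mul_one]
  -- row and column bounds
  have hrow : ∀ i, ∑ j, |inner ℝ (bs i) (M (bs j))| * |inner ℝ (bs j) (M' (bs i))| ≤ ‖M‖ * ‖M'‖ :=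
    fun i => sum_abs_inner_mul_abs_inner_le bs M M' i
  have hcol : ∀ j, ∑ i, |inner ℝ (bs i) (M (bs j))| * |inner ℝ (bs j) (M' (bs i))| ≤ ‖M‖ * ‖M'‖ := by
    intro j
    have h := sum_abs_inner_mul_abs_inner_le bs M' M j
    calc ∑ i, |inner ℝ (bs i) (M (bs j))| * |inner ℝ (bs j) (M' (bs i))|
        = ∑ i, |inner ℝ (bs j) (M' (bs i))| * |inner ℝ (bs i) (M (bs j))| :=
          Finset.sum_congr rfl fun i _ => mul_comm _ _
      _ ≤ ‖M'‖ * ‖M‖ := h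
      _ = ‖M‖ * ‖M'‖ := mul_comm _ _
  -- assemble
  rw [htr, htrS]
  calc |∑ i, ∑ j, μ i ^ a * μ j ^ b * (inner ℝ (bs i) (M (bs j)) * inner ℝ (bs j) (M' (bs i)))|
      ≤ ∑ i, ∑ j, |μ i ^ a * μ j ^ b * (inner ℝ (bs i) (M (bs j)) * inner ℝ (bs j) (M' (bs i)))| := by
        refine (Finset.abs_sum_le_sum_abs _ _).trans (Finset.sum_le_sum fun i _ => ?_)
        exact Finset.abs_sum_le_sum_abs _ _
    _ = ∑ i, ∑ j, μ i ^ a * μ j ^ b * (|inner ℝ (bs i) (M (bs j))| * |inner ℝ (bs j) (M' (bs i))|) := by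
        refine Finset.sum_congr rfl fun i _ => Finset.sum_congr rfl fun j _ => ?_
        rw [abs_mul, abs_mul, abs_mul, abs_of_nonneg (pow_nonneg (hμ0 i) a),
          abs_of_nonneg (pow_nonneg (hμ0 j) b)]
    _ ≤ ∑ i, ∑ j, (μ i ^ (a + b) + μ j ^ (a + b)) *
          (|inner ℝ (bs i) (M (bs j))| * |inner ℝ (bs j) (M' (bs i))|) := by
        refine Finset.sum_le_sum fun i _ => Finset.sum_le_sum fun j _ => ?_
        exact mul_le_mul_of_nonneg_right (pow_mul_pow_le_add (hμ0 i) (hμ0 j) a b)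
          (mul_nonneg (abs_nonneg _) (abs_nonneg _))
    _ = ∑ i, μ i ^ (a + b) * ∑ j, |inner ℝ (bs i) (M (bs j))| * |inner ℝ (bs j) (M' (bs i))| +
        ∑ j, μ j ^ (a + b) * ∑ i, |inner ℝ (bs i) (M (bs j))| * |inner ℝ (bs j) (M' (bs i))| := by
        simp only [add_mul, Finset.sum_add_distrib, Finset.mul_sum]
        congr 1
        rw [Finset.sum_comm]
    _ ≤ ∑ i, μ i ^ (a + b) * (‖M‖ * ‖M'‖) + ∑ j, μ j ^ (a + b) * (‖M‖ * ‖M'‖) := by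
        gcongr with i _ j _
        · exact pow_nonneg (hμ0 i) _
        · exact hrow i
        · exact pow_nonneg (hμ0 j) _
        · exact hcol j
    _ = 2 * ‖M‖ * ‖M'‖ * ∑ i, μ i ^ (a + b) := by
        rw [← Finset.sum_mul]
        ring

end Young

/-! ## §2 The remainders `Tᵐ − |Ω⟩⟨Ω|`: products, powers, monotonicity of the trace excess -/

section Remainder

variable {E : Type*} [NormedAddCommGroup E] [InnerProductSpace ℝ E]

/-- `Tᵐ ∘ |Ω⟩⟨Ω| = |Ω⟩⟨Ω|` when `T Ω = Ω`. [folklore] -/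
theorem pow_mul_rankOne_eq (T : E →L[ℝ] E) {Ω : E} (hTΩ : T Ω = Ω) (m : ℕ) :
    T ^ m * rankOne ℝ Ω Ω = rankOne ℝ Ω Ω := by
  induction m with
  | zero => rw [pow_zero, one_mul]
  | succ m ih =>
    rw [pow_succ, mul_assoc, ContinuousLinearMap.mul_def T, comp_rankOne, hTΩ, ih]

/-- `|Ω⟩⟨Ω| ∘ Tᵐ = |Ω⟩⟨Ω|` when `T` is positive (symmetric) and `T Ω = Ω`. [folklore] -/
theorem rankOne_mul_pow_eq {T : E →L[ℝ] E} (hT : T.IsPositive) {Ω : E} (hTΩ : T Ω = Ω) (m : ℕ) :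
    rankOne ℝ Ω Ω * T ^ m = rankOne ℝ Ω Ω := by
  have h1 : rankOne ℝ Ω Ω * T = rankOne ℝ Ω Ω := by
    ext v
    rw [ContinuousLinearMap.mul_def, ContinuousLinearMap.comp_apply, rankOne_apply, rankOne_apply,
      ← hT.inner_left_eq_inner_right, hTΩ]
  induction m with
  | zero => rw [pow_zero, mul_one]
  | succ m ih => rw [pow_succ', ← mul_assoc, h1, ih]

/-- **Product rule for the remainders:** `(Tˢ − P)(Tᵗ − P) = T^{s+t} − P`, `P = |Ω⟩⟨Ω|`, `‖Ω‖ = 1`, `T Ω = Ω`,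
`T ≥ 0`. [folklore] -/
theorem pow_sub_rankOne_mul {T : E →L[ℝ] E} (hT : T.IsPositive) {Ω : E} (hΩ : ‖Ω‖ = 1)
    (hTΩ : T Ω = Ω) (s t : ℕ) :
    (T ^ s - rankOne ℝ Ω Ω) * (T ^ t - rankOne ℝ Ω Ω) = T ^ (s + t) - rankOne ℝ Ω Ω := by
  have hPP : rankOne ℝ Ω Ω * rankOne ℝ Ω Ω = rankOne ℝ Ω Ω :=
    isIdempotentElem_rankOne_self (𝕜 := ℝ) hΩ
  rw [sub_mul, mul_sub, mul_sub, ← pow_add, pow_mul_rankOne_eq T hTΩ, rankOne_mul_pow_eq hT hTΩ, hPP]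
  abel

/-- Powers of the first remainder: `(T − P)ᵃ = Tᵃ − P` for `a ≥ 1`. [folklore] -/
theorem sub_rankOne_pow {T : E →L[ℝ] E} (hT : T.IsPositive) {Ω : E} (hΩ : ‖Ω‖ = 1)
    (hTΩ : T Ω = Ω) {a : ℕ} (ha : 1 ≤ a) :
    (T - rankOne ℝ Ω Ω) ^ a = T ^ a - rankOne ℝ Ω Ω := by
  induction a, ha using Nat.le_induction with
  | base => rw [pow_one, pow_one]
  | succ a _ ih =>
    rw [pow_succ, ih]
    conv_lhs => rw [show (T - rankOne ℝ Ω Ω) = T ^ 1 - rankOne ℝ Ω Ω by rw [pow_one]]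
    rw [pow_sub_rankOne_mul hT hΩ hTΩ a 1]

variable [FiniteDimensional ℝ E]

/-- **Monotonicity of the model trace excess:** `tr Tᵗ − 1 ≤ r^{t − t₀} (tr T^{t₀} − 1)` for `t₀ ≤ t`, when `T ≥ 0`,
`T Ω = Ω`, `‖Ω‖ = 1` and `T` contracts at rate `r ≥ 0` on `Ω^⊥` (`Σ_{i≠0} μᵢᵗ ≤ r^{t−t₀} Σ_{i≠0} μᵢ^{t₀}`). [folklore] -/
theorem trace_excess_le_pow_mul {d : ℕ} (T : EuclideanSpace ℝ (Fin d) →L[ℝ] EuclideanSpace ℝ (Fin d))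
    (Ω : EuclideanSpace ℝ (Fin d)) {r : ℝ} (hT : T.IsPositive) (hΩ : ‖Ω‖ = 1) (hTΩ : T Ω = Ω)
    (hr : 0 ≤ r) (hcon : ∀ v, inner ℝ Ω v = 0 → ‖T v‖ ≤ r * ‖v‖) {t₀ t : ℕ} (h : t₀ ≤ t) :
    LinearMap.trace ℝ _ (↑(T ^ t) : EuclideanSpace ℝ (Fin d) →ₗ[ℝ] EuclideanSpace ℝ (Fin d)) - 1 ≤
      r ^ (t - t₀) *
        (LinearMap.trace ℝ _ (↑(T ^ t₀) : EuclideanSpace ℝ (Fin d) →ₗ[ℝ] EuclideanSpace ℝ (Fin d)) - 1) := by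
  obtain ⟨hpos0, -, htr0⟩ := toolkit_powSubRankOne d T Ω r t₀ hT hΩ hTΩ hr hcon
  obtain ⟨-, hnorm1, -⟩ := toolkit_powSubRankOne d T Ω r (t - t₀) hT hΩ hTΩ hr hcon
  obtain ⟨-, -, htr⟩ := toolkit_powSubRankOne d T Ω r t hT hΩ hTΩ hr hcon
  have hprod : (T ^ t₀ - rankOne ℝ Ω Ω) * (T ^ (t - t₀) - rankOne ℝ Ω Ω) = T ^ t - rankOne ℝ Ω Ω := by
    rw [pow_sub_rankOne_mul hT hΩ hTΩ, Nat.add_sub_cancel' h]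
  have hH := stub_traceHolder d _ (T ^ (t - t₀) - rankOne ℝ Ω Ω) hpos0
  rw [hprod] at hH
  have htr0nn : 0 ≤ LinearMap.trace ℝ _
      (↑(T ^ t₀ - rankOne ℝ Ω Ω) : EuclideanSpace ℝ (Fin d) →ₗ[ℝ] EuclideanSpace ℝ (Fin d)) :=
    hpos0.toLinearMap.trace_nonneg
  rw [← htr, ← htr0]
  calc LinearMap.trace ℝ _ (↑(T ^ t - rankOne ℝ Ω Ω) : EuclideanSpace ℝ (Fin d) →ₗ[ℝ] EuclideanSpace ℝ (Fin d))
      ≤ |LinearMap.trace ℝ _ (↑(T ^ t - rankOne ℝ Ω Ω) : EuclideanSpace ℝ (Fin d) →ₗ[ℝ] EuclideanSpace ℝ (Fin d))| :=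
        le_abs_self _
    _ ≤ LinearMap.trace ℝ _ (↑(T ^ t₀ - rankOne ℝ Ω Ω) : EuclideanSpace ℝ (Fin d) →ₗ[ℝ] EuclideanSpace ℝ (Fin d)) *
          ‖T ^ (t - t₀) - rankOne ℝ Ω Ω‖ := hH
    _ ≤ LinearMap.trace ℝ _ (↑(T ^ t₀ - rankOne ℝ Ω Ω) : EuclideanSpace ℝ (Fin d) →ₗ[ℝ] EuclideanSpace ℝ (Fin d)) *
          r ^ (t - t₀) := mul_le_mul_of_nonneg_left hnorm1 htr0nn
    _ = _ := mul_comm _ _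

/-- **The thermal double sum at total time:** `|tr((Tᵃ − P)(A (Tᵇ − P) B))| ≤ 2‖A‖‖B‖ (tr T^{a+b} − 1)` for `a, b ≥ 1`
(`(Tᵐ − P) = (T − P)ᵐ`, `T − P ≥ 0`, `abs_trace_pow_mul_pow_mul_le`). [folklore] -/
theorem abs_trace_remainder_mul_le {d : ℕ} (T A B : EuclideanSpace ℝ (Fin d) →L[ℝ] EuclideanSpace ℝ (Fin d))
    (Ω : EuclideanSpace ℝ (Fin d)) {r : ℝ} (hT : T.IsPositive) (hΩ : ‖Ω‖ = 1) (hTΩ : T Ω = Ω) (hr : 0 ≤ r)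
    (hcon : ∀ v, inner ℝ Ω v = 0 → ‖T v‖ ≤ r * ‖v‖) {a b : ℕ} (ha : 1 ≤ a) (hb : 1 ≤ b) :
    |LinearMap.trace ℝ _ (↑((T ^ a - rankOne ℝ Ω Ω) * (A * (T ^ b - rankOne ℝ Ω Ω) * B)) :
        EuclideanSpace ℝ (Fin d) →ₗ[ℝ] EuclideanSpace ℝ (Fin d))| ≤
      2 * ‖A‖ * ‖B‖ *
        (LinearMap.trace ℝ _ (↑(T ^ (a + b)) : EuclideanSpace ℝ (Fin d) →ₗ[ℝ] EuclideanSpace ℝ (Fin d)) - 1) := by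
  obtain ⟨hpos1, -, -⟩ := toolkit_powSubRankOne d T Ω r 1 hT hΩ hTΩ hr hcon
  rw [pow_one] at hpos1
  have hab : 1 ≤ a + b := le_add_right ha
  have e : (T ^ a - rankOne ℝ Ω Ω) * (A * (T ^ b - rankOne ℝ Ω Ω) * B) =
      (T - rankOne ℝ Ω Ω) ^ a * A * (T - rankOne ℝ Ω Ω) ^ b * B := by
    rw [sub_rankOne_pow hT hΩ hTΩ ha, sub_rankOne_pow hT hΩ hTΩ hb]
    noncomm_ring
  rw [e, ← trace_pow_sub_rankOne_eq T hΩ (a + b), ← sub_rankOne_pow hT hΩ hTΩ hab]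
  exact abs_trace_pow_mul_pow_mul_le hpos1 A B a b

end Remainder

end Summit.QuantumFields.YangMills.Cruxes.IR.VacuumEscape.SpectralSeam

end
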